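import Literature.MathematicalPhysics.QuantumFieldTheory.TphiSeminorm
import Mathlib.Analysis.Calculus.ParametricIntegral
import Mathlib.MeasureTheory.Integral.Bochner.ContinuousLinearMap
import HarnessLib

/-!
# Expectation and the `T_φ`-seminorm: `‖𝔼 F_ζ‖_{T_φ} ≤ 𝔼 ‖F_ζ‖_{T_φ}` and `‖θ_ζ F‖_{T_φ} = ‖F‖_{T_{φ+ζ}}`

Bauerschmidt–Brydges–Slade 2019, Proposition 7.3.1: the two facts by which convolution (Gaussian
expectation of a translated functional, the basic operation of a renormalisation group step) is
controlled in the `T_φ`-seminorm (`TphiSeminorm.lean`):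

* `tphiSeminorm_comp_add_right` — **translation**: `‖F(· + ζ)‖_{T_φ(𝔥)} = ‖F‖_{T_{φ+ζ}(𝔥)}`
  (BBS (7.3.1), "commuting derivatives with the translation");
* `iteratedFDeriv_integral_eq`, `integrable_iteratedFDeriv_of_dominated` — **differentiation under
  the integral sign to all orders `≤ N`** for a parametrised family `x ↦ ∫ F(x, ζ) dμ(ζ)` whose
  `x`-derivatives of orders `≤ N` are locally (in `x`) dominated by integrable functions of `ζ`:
  `Dᵖ ∫ F(·,ζ) dμ = ∫ Dᵖ F(·,ζ) dμ` (iterated `hasFDerivAt_integral_of_dominated_of_fderiv_le`);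
* `tphiSeminorm_integral_le` — **BBS (7.3.2)**: `‖∫ F(·,ζ) dμ‖_{T_φ(𝔥)} ≤ ∫ ‖F(·,ζ)‖_{T_φ(𝔥)} dμ`
  ("commuting derivatives past the expectation"), for any measure `μ` (in particular the
  fluctuation Gaussian); with the translation lemma this gives BBS (7.3.3)
  `‖𝔼_C θ F‖_{T_φ} ≤ 𝔼_C ‖F‖_{T_{φ+ζ}}` (`tphiSeminorm_integral_comp_add_le`).

No definitions, no named facts.

## References

* R. Bauerschmidt, D. C. Brydges, G. Slade, *Introduction to a Renormalisation Group Method*,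
  LNM 2242 (2019), Proposition 7.3.1, (7.3.1)–(7.3.3). [BauerschmidtBrydgesSlade2019RG]
-/

noncomputable section

namespace Literature.MathematicalPhysics.QuantumFieldTheory

open Finset MeasureTheory Filter Topology Set Metric

variable {E : Type*} [NormedAddCommGroup E] [NormedSpace ℝ E]
variable {A : Type*} [NormedRing A] [NormedAlgebra ℝ A]

/-! ### Translation -/

/-- **Translation invariance**: `‖F(· + ζ)‖_{T_φ(𝔥)} = ‖F‖_{T_{φ+ζ}(𝔥)}`. [cite: BauerschmidtBrydgesSlade2019RG, Prop. 7.3.1] -/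
theorem tphiSeminorm_comp_add_right (N : ℕ) (𝔥 : ℝ) (F : E → A) (ζ φ : E) :
    tphiSeminorm N 𝔥 (fun x => F (x + ζ)) φ = tphiSeminorm N 𝔥 F (φ + ζ) := by
  unfold tphiSeminorm
  refine sum_congr rfl fun p _ => ?_
  rw [iteratedFDeriv_comp_add_right]

/-- Translation on the left: `‖F(ζ + ·)‖_{T_φ(𝔥)} = ‖F‖_{T_{ζ+φ}(𝔥)}`. [cite: BauerschmidtBrydgesSlade2019RG, Prop. 7.3.1] -/
theorem tphiSeminorm_comp_add_left (N : ℕ) (𝔥 : ℝ) (F : E → A) (ζ φ : E) :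
    tphiSeminorm N 𝔥 (fun x => F (ζ + x)) φ = tphiSeminorm N 𝔥 F (ζ + φ) := by
  unfold tphiSeminorm
  refine sum_congr rfl fun p _ => ?_
  rw [iteratedFDeriv_comp_add_left]

/-! ### Differentiation under the integral sign to all orders -/

section Integral

variable {Z : Type*} [MeasurableSpace Z] {μ : Measure Z}

/-- **Local domination of the derivatives** of a parametrised family `F : E → Z → A` up to order `N`:
every `x`-derivative of order `p ≤ N` is measurable in `ζ` and, locally uniformly in `x`, bounded by a
`μ`-integrable function of `ζ`. [folklore] -/
structure DerivDominated (N : ℕ) (F : E → Z → A) (μ : Measure Z) : Prop where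
  contDiff : ∀ z, ContDiff ℝ N (fun x => F x z)
  meas : ∀ p, p ≤ N → ∀ x, AEStronglyMeasurable (fun z => iteratedFDeriv ℝ p (fun y => F y z) x) μ
  bound : ∀ p, p ≤ N → ∀ x₀ : E, ∃ bound : Z → ℝ, Integrable bound μ ∧ ∃ ε > 0,
    ∀ᵐ z ∂μ, ∀ x ∈ ball x₀ ε, ‖iteratedFDeriv ℝ p (fun y => F y z) x‖ ≤ bound z

/-- Dominated derivatives are integrable. [folklore] -/
theorem DerivDominated.integrable {N : ℕ} {F : E → Z → A} (h : DerivDominated N F μ) {p : ℕ} (hp : p ≤ N)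
    (x : E) : Integrable (fun z => iteratedFDeriv ℝ p (fun y => F y z) x) μ := by
  obtain ⟨bound, hbi, ε, hε, hb⟩ := h.bound p hp x
  refine Integrable.mono' hbi (h.meas p hp x) ?_
  filter_upwards [hb] with z hz
  exact hz x (mem_ball_self hε)

/-- The family itself is integrable (order `0`). [folklore] -/
theorem DerivDominated.integrable_zero {N : ℕ} {F : E → Z → A} (h : DerivDominated N F μ) (x : E) :
    Integrable (fun z => F x z) μ := by
  have h0 := (h.integrable (Nat.zero_le N) x).norm
  have hm : AEStronglyMeasurable (fun z => F x z) μ := by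
    have := (continuousMultilinearCurryFin0 ℝ E A).continuous.comp_aestronglyMeasurable (h.meas 0 (Nat.zero_le N) x)
    refine this.congr (ae_of_all _ fun z => ?_)
    simp [iteratedFDeriv_zero_eq_comp]
  refine Integrable.mono' h0 hm (ae_of_all _ fun z => ?_)
  simp [norm_iteratedFDeriv_zero]

variable [CompleteSpace A]

/-- **Differentiation under the integral sign, all orders**: under local domination of the
derivatives up to order `N`, `Dᵖ (∫ F(·,ζ) dμ)(x) = ∫ Dᵖ F(·,ζ)(x) dμ` for every `p ≤ N` and every `x`.
[cite: BauerschmidtBrydgesSlade2019RG, Prop. 7.3.1] -/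
theorem DerivDominated.iteratedFDeriv_integral_eq {N : ℕ} {F : E → Z → A} (h : DerivDominated N F μ) :
    ∀ p, p ≤ N → ∀ x, iteratedFDeriv ℝ p (fun y => ∫ z, F y z ∂μ) x = ∫ z, iteratedFDeriv ℝ p (fun y => F y z) x ∂μ := by
  intro p
  induction p with
  | zero =>
    intro _ x
    rw [iteratedFDeriv_zero_eq_comp, Function.comp_apply]
    have e : (fun z => iteratedFDeriv ℝ 0 (fun y => F y z) x) =
        fun z => (continuousMultilinearCurryFin0 ℝ E A).symm (F x z) := by
      funext z; rw [iteratedFDeriv_zero_eq_comp, Function.comp_apply]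
    rw [e]
    exact ((continuousMultilinearCurryFin0 ℝ E A).symm.toLinearIsometry.integral_comp_comm _).symm
  | succ p ih =>
    intro hp x
    have hpN : p ≤ N := Nat.le_of_succ_le hp
    -- the order-`p` derivative of the integral, as a function
    set I : E → E [×p]→L[ℝ] A := fun y => ∫ z, iteratedFDeriv ℝ p (fun y => F y z) y ∂μ with hI
    have hIeq : iteratedFDeriv ℝ p (fun y => ∫ z, F y z ∂μ) = I := funext fun y => ih hpN y
    -- differentiate `I` under the integral sign
    set G' : E → Z → (E →L[ℝ] E [×p]→L[ℝ] A) := fun y z => fderiv ℝ (iteratedFDeriv ℝ p (fun y => F y z)) y with hG'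
    obtain ⟨bound, hbi, ε, hε, hb⟩ := h.bound (p + 1) hp x
    have hderiv : HasFDerivAt I (∫ z, G' x z ∂μ) x := by
      refine hasFDerivAt_integral_of_dominated_of_fderiv_le (F' := G') (bound := bound) (ball_mem_nhds x hε)
        (Eventually.of_forall fun y => h.meas p hpN y) (h.integrable hpN x) ?_ ?_ hbi ?_
      · -- measurability of `G' x` through the curry isometry
        have e : G' x = fun z => (continuousMultilinearCurryLeftEquiv ℝ (fun _ : Fin (p + 1) => E) A)
            (iteratedFDeriv ℝ (p + 1) (fun y => F y z) x) := by
          funext z; simp only [hG']; rw [fderiv_iteratedFDeriv]; rfl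
        rw [e]
        exact (continuousMultilinearCurryLeftEquiv ℝ (fun _ : Fin (p + 1) => E) A).continuous.comp_aestronglyMeasurable
          (h.meas (p + 1) hp x)
      · filter_upwards [hb] with z hz y hy
        simp only [hG']
        rw [norm_fderiv_iteratedFDeriv]
        exact hz y hy
      · exact ae_of_all _ fun z y _ =>
          (((h.contDiff z).differentiable_iteratedFDeriv (by exact_mod_cast Nat.lt_of_succ_le hp)) y).hasFDerivAt
    -- assemble the `(p+1)`-st derivative
    set cL := continuousMultilinearCurryLeftEquiv ℝ (fun _ : Fin (p + 1) => E) A with hcL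
    have hcomm : ∫ z, cL.symm (G' x z) ∂μ = cL.symm (∫ z, G' x z ∂μ) := by
      have h := ContinuousLinearEquiv.integral_comp_comm (X := Z) (𝕜 := ℝ) (μ := μ)
        (E := E →L[ℝ] (E [×p]→L[ℝ] A)) (F := E [×(p + 1)]→L[ℝ] A) cL.symm.toContinuousLinearEquiv (fun z => G' x z)
      simpa only [LinearIsometryEquiv.coe_toContinuousLinearEquiv] using h
    rw [iteratedFDeriv_succ_eq_comp_left, Function.comp_apply, hIeq, hderiv.fderiv, ← hcL, ← hcomm]
    refine integral_congr_ae (ae_of_all _ fun z => ?_)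
    simp only [hG']
    rw [iteratedFDeriv_succ_eq_comp_left, Function.comp_apply]

/-- **BBS (7.3.2): the expectation contracts the `T_φ`-seminorm** — `‖∫ F(·,ζ) dμ‖_{T_φ(𝔥)} ≤ ∫ ‖F(·,ζ)‖_{T_φ(𝔥)} dμ`
for any measure `μ`, under local domination of the derivatives up to the Taylor order `N`.
[cite: BauerschmidtBrydgesSlade2019RG, Prop. 7.3.1] -/
theorem tphiSeminorm_integral_le (N : ℕ) {𝔥 : ℝ} (h𝔥 : 0 ≤ 𝔥) {F : E → Z → A} (h : DerivDominated N F μ) (φ : E) :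
    tphiSeminorm N 𝔥 (fun y => ∫ z, F y z ∂μ) φ ≤ ∫ z, tphiSeminorm N 𝔥 (fun y => F y z) φ ∂μ := by
  unfold tphiSeminorm
  rw [integral_finsetSum _ fun p hp => ((h.integrable (Nat.lt_succ_iff.1 (mem_range.1 hp)) φ).norm.const_mul _)]
  refine sum_le_sum fun p hp => ?_
  have hpN : p ≤ N := Nat.lt_succ_iff.1 (mem_range.1 hp)
  rw [integral_const_mul, h.iteratedFDeriv_integral_eq p hpN φ]
  exact mul_le_mul_of_nonneg_left (norm_integral_le_integral_norm _) (by positivity)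

/-- **BBS (7.3.3), one factor: convolution** — `‖∫ F(· + ζ) dμ(ζ)‖_{T_φ(𝔥)} ≤ ∫ ‖F‖_{T_{φ+ζ}(𝔥)} dμ(ζ)`
(expectation of the translate, e.g. by the fluctuation field). [cite: BauerschmidtBrydgesSlade2019RG, Prop. 7.3.1] -/
theorem tphiSeminorm_integral_comp_add_le [MeasurableSpace E] (N : ℕ) {𝔥 : ℝ} (h𝔥 : 0 ≤ 𝔥) {F : E → A} {μ : Measure E}
    (h : DerivDominated N (fun (y ζ : E) => F (y + ζ)) μ) (φ : E) :
    tphiSeminorm N 𝔥 (fun y => ∫ ζ, F (y + ζ) ∂μ) φ ≤ ∫ ζ, tphiSeminorm N 𝔥 F (φ + ζ) ∂μ := by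
  have h1 := tphiSeminorm_integral_le N h𝔥 h φ
  simp_rw [tphiSeminorm_comp_add_right] at h1
  exact h1

end Integral

end Literature.MathematicalPhysics.QuantumFieldTheory

end
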